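import Summits.MatrixMultiplication.MatrixMultiplication.Theorems.LieRankDesigns.Negative.DetTwist
import Summits.MatrixMultiplication.MatrixMultiplication.Theorems.LevelOneGL2Designs.Negative.LevelSpace

/-!
# Negative lemmas for the crux `LieRankDesigns` (stmt-MatrixMultiplication-7614), part E: isotropy of low levels

Refuter-side (cdisprove) support; no theorem asserts a Theses statement positively.  `p` odd, `2k < m`.

* `rank_add_le`, `sum_fourierFn_mul_fourierFn_mul_detChar_eq_zero`: the level `F_k` is
  `θ∘det`-ISOTROPIC (`F_k · F_k ⊆ F_{2k} ⊥ θ∘det`);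
* (`quadProducts = X⁻¹YY⁻¹Z` and `sep_apply_of_mem_quadProducts` are `LevelOneGL2Designs.Negative.LevelSpace`);
* `card_XZ_add_card_quadProducts_le`: ISOTROPY BOUND `|X||Z| + |X⁻¹YY⁻¹Z| ≤ |GL_m(𝔽_p)|` (`Y ≠ ∅`):
  the separators restricted to `G ∖ P` have Gram matrix `−diag θ(det t)` under the twisted pairing,
  hence are linearly independent in `ℂ^{G ∖ P}`;
* `card_XY_le_card_quadProducts`, `card_XZ_add_card_XY_le`.
-/

noncomputable section

open scoped BigOperators
open Literature.RepresentationTheory.FiniteGroups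

namespace Summit.MatrixMultiplication.MatrixMultiplication.Theorems.LieRankDesigns.Negative

open Summit.MatrixMultiplication.MatrixMultiplication.Theses.LevelGradedCohnUmans
open Summit.MatrixMultiplication.MatrixMultiplication.Theorems.LevelOneGL2Designs.Negative
  (quadProducts mem_quadProducts sep_apply_of_mem_quadProducts)

variable {p m : ℕ}

/-! ## ISOTROPY of low levels and the bound `|X||Z| + |X⁻¹YY⁻¹Z| ≤ |G|` (`p` odd, `2k < m`) -/

section Isotropy

variable [Fact p.Prime]

/-- Rank is subadditive. [folklore] -/
theorem rank_add_le (A B : Mat p m) : (A + B).rank ≤ A.rank + B.rank := by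
  unfold Matrix.rank
  rw [Matrix.mulVecLin_add]
  exact (Submodule.finrank_mono (LinearMap.range_add_le _ _)).trans
    (Submodule.finrank_add_le_finrank_add_finrank _ _)

/-- **Low levels are `θ∘det`-isotropic**: for `p` odd and `2k < m`, the pointwise product of two
level-`k` functions has Fourier support in rank `≤ 2k < m`, hence is orthogonal to `θ∘det`:
`Σ_g f₁(g) f₂(g) θ(det g) = 0`. -/
theorem sum_fourierFn_mul_fourierFn_mul_detChar_eq_zero (hp : p ≠ 2) {k : ℕ} (hkm : 2 * k < m)
    {c c' : Mat p m → ℂ} (hc : RankSupp k c) (hc' : RankSupp k c') :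
    ∑ g : GLm p m, fourierFn c g * fourierFn c' g * ((quadraticChar (ZMod p) ((g : GLm p m) : Mat p m).det : ℤ) : ℂ) = 0 := by
  have key : ∀ M M' : Mat p m, c M * c' M' *
      ∑ g : GLm p m, ZMod.stdAddChar (Matrix.trace ((M + M') * (g : Mat p m))) * ((quadraticChar (ZMod p) ((g : GLm p m) : Mat p m).det : ℤ) : ℂ) = 0 := by
    intro M M'
    by_cases hM : k < M.rank
    · rw [hc M hM]; simp
    by_cases hM' : k < M'.rank
    · rw [hc' M' hM']; simp
    rw [sum_psi_mul_detChar_eq_zero hp (lt_of_le_of_lt (rank_add_le M M') (by omega)), mul_zero]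
  unfold fourierFn
  calc ∑ g : GLm p m, (∑ M : Mat p m, c M * ZMod.stdAddChar (Matrix.trace (M * (g : Mat p m)))) *
        (∑ M' : Mat p m, c' M' * ZMod.stdAddChar (Matrix.trace (M' * (g : Mat p m)))) * ((quadraticChar (ZMod p) ((g : GLm p m) : Mat p m).det : ℤ) : ℂ)
      = ∑ g : GLm p m, ∑ M : Mat p m, ∑ M' : Mat p m, c M * c' M' *
          (ZMod.stdAddChar (Matrix.trace ((M + M') * (g : Mat p m))) * ((quadraticChar (ZMod p) ((g : GLm p m) : Mat p m).det : ℤ) : ℂ)) := by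
        refine Finset.sum_congr rfl fun g _ => ?_
        rw [Finset.sum_mul, Finset.sum_mul]
        refine Finset.sum_congr rfl fun M _ => ?_
        rw [Finset.mul_sum, Finset.sum_mul]
        refine Finset.sum_congr rfl fun M' _ => ?_
        rw [Matrix.add_mul, Matrix.trace_add, AddChar.map_add_eq_mul]
        ring
    _ = ∑ M : Mat p m, ∑ M' : Mat p m, c M * c' M' *
          ∑ g : GLm p m, ZMod.stdAddChar (Matrix.trace ((M + M') * (g : Mat p m))) * ((quadraticChar (ZMod p) ((g : GLm p m) : Mat p m).det : ℤ) : ℂ) := by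
        rw [Finset.sum_comm]
        refine Finset.sum_congr rfl fun M _ => ?_
        rw [Finset.sum_comm]
        refine Finset.sum_congr rfl fun M' _ => ?_
        rw [Finset.mul_sum]
    _ = 0 := Finset.sum_eq_zero fun M _ => Finset.sum_eq_zero fun M' _ => key M M'

variable {k : ℕ} {X Y Z : Finset (GLm p m)}

/-- **ISOTROPY BOUND.**  For `p` odd and `2k < m`, an `F_k`-separated triple with `Y ≠ ∅` satisfies
`|X|·|Z| + |X⁻¹ Y Y⁻¹ Z| ≤ |GL_m(𝔽_p)|`: the quadruple-product set must MISS at least `|X||Z|`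
group elements.  Proof: the separating functions `f_t` (`t ∈ X⁻¹Z`) are `θ∘det`-isotropic
(`Σ f_t f_{t'} θ = 0`) and equal `δ_t` on `P`, so their restrictions to `G ∖ P` have the invertible
Gram matrix `−diag(θ(det t))` and are linearly independent in `ℂ^{G∖P}`. -/
theorem card_XZ_add_card_quadProducts_le (hp : p ≠ 2) (hkm : 2 * k < m) (hsep : RankSep k X Y Z)
    (hY : Y.Nonempty) :
    X.card * Z.card + (quadProducts X Y Z).card ≤ Fintype.card (GLm p m) := by
  classical
  obtain ⟨y₀, hy₀⟩ := hY
  set P := quadProducts X Y Z with hPdef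
  set T : Type := ↥(X ×ˢ Z)
  -- separating tables, one per target pair
  have hq : ∀ q : T, ∃ c : Mat p m → ℂ, RankSupp k c ∧ ∀ x ∈ X, ∀ y ∈ Y, ∀ y' ∈ Y, ∀ z ∈ Z,
      fourierFn c (x⁻¹ * y * y'⁻¹ * z) = if x = q.1.1 ∧ y = y' ∧ z = q.1.2 then 1 else 0 :=
    fun q => hsep q.1.1 (Finset.mem_product.mp q.2).1 q.1.2 (Finset.mem_product.mp q.2).2
  choose c hc hsepc using hq
  set t : T → GLm p m := fun q => q.1.1⁻¹ * q.1.2 with htdef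
  have ht_mem : ∀ q : T, t q ∈ P := fun q => by
    rw [show t q = q.1.1⁻¹ * y₀ * y₀⁻¹ * q.1.2 by simp only [htdef]; group]
    exact mem_quadProducts (Finset.mem_product.mp q.2).1 hy₀ hy₀ (Finset.mem_product.mp q.2).2
  have hfP : ∀ q : T, ∀ g ∈ P, fourierFn (c q) g = if g = t q then 1 else 0 := fun q g hg =>
    sep_apply_of_mem_quadProducts (Finset.mem_product.mp q.2).1 (Finset.mem_product.mp q.2).2
      (hsepc q) hg
  have ht_inj : ∀ q q' : T, t q = t q' → q = q' := by
    intro q q' he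
    have h1 := hfP q (t q) (ht_mem q)
    rw [if_pos rfl] at h1
    have h2 := hsepc q q'.1.1 (Finset.mem_product.mp q'.2).1 y₀ hy₀ y₀ hy₀ q'.1.2
      (Finset.mem_product.mp q'.2).2
    rw [show q'.1.1⁻¹ * y₀ * y₀⁻¹ * q'.1.2 = t q' by simp only [htdef]; group, ← he, h1] at h2
    by_cases hc' : q'.1.1 = q.1.1 ∧ y₀ = y₀ ∧ q'.1.2 = q.1.2
    · exact Subtype.ext (Prod.ext hc'.1.symm hc'.2.2.symm)
    · rw [if_neg hc'] at h2; exact absurd h2 one_ne_zero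
  -- the complement E = G \ P and the two matrices
  set E := (Finset.univ : Finset (GLm p m)) \ P with hEdef
  set Emat : Matrix T ↥E ℂ := fun q g => fourierFn (c q) g with hEmat
  set Dθ : Matrix ↥E ↥E ℂ := Matrix.diagonal fun g => ((quadraticChar (ZMod p) ((g : GLm p m) : Mat p m).det : ℤ) : ℂ) with hDθ
  have hgram : Emat * Dθ * Emat.transpose = -Matrix.diagonal fun q => ((quadraticChar (ZMod p) (((t q) : GLm p m) : Mat p m).det : ℤ) : ℂ) := by
    ext q q'
    rw [Matrix.mul_apply]
    simp only [hDθ, Matrix.mul_diagonal, Matrix.transpose_apply, Matrix.neg_apply,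
      Matrix.diagonal_apply]
    -- Σ over ↥E as a Finset sum
    rw [show (∑ g : ↥E, Emat q g * ((quadraticChar (ZMod p) ((g : GLm p m) : Mat p m).det : ℤ) : ℂ) * Emat q' g) =
        ∑ g ∈ E, fourierFn (c q) g * fourierFn (c q') g * ((quadraticChar (ZMod p) ((g : GLm p m) : Mat p m).det : ℤ) : ℂ) from by
      rw [← Finset.sum_coe_sort E]
      refine Finset.sum_congr rfl fun g _ => ?_
      simp only [hEmat]; ring]
    have htot := sum_fourierFn_mul_fourierFn_mul_detChar_eq_zero hp hkm (hc q) (hc q')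
    rw [← Finset.sum_sdiff (Finset.subset_univ P)] at htot
    have hP : ∑ g ∈ P, fourierFn (c q) g * fourierFn (c q') g * ((quadraticChar (ZMod p) ((g : GLm p m) : Mat p m).det : ℤ) : ℂ) =
        if q = q' then ((quadraticChar (ZMod p) (((t q) : GLm p m) : Mat p m).det : ℤ) : ℂ) else 0 := by
      rw [Finset.sum_congr rfl fun g hg => by rw [hfP q g hg, hfP q' g hg]]
      simp only [ite_mul, one_mul, zero_mul]
      rw [Finset.sum_ite_eq' P (t q), if_pos (ht_mem q)]
      by_cases hqq : q = q'
      · subst hqq; simp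
      · rw [if_neg (fun h => hqq (ht_inj q q' h)), if_neg hqq]
    rw [hP] at htot
    have : ∑ g ∈ E, fourierFn (c q) g * fourierFn (c q') g * ((quadraticChar (ZMod p) ((g : GLm p m) : Mat p m).det : ℤ) : ℂ) =
        -(if q = q' then ((quadraticChar (ZMod p) (((t q) : GLm p m) : Mat p m).det : ℤ) : ℂ) else 0) := eq_neg_of_add_eq_zero_left htot
    rw [this]
  -- ranks
  have hunit : IsUnit (-Matrix.diagonal fun q : T => ((quadraticChar (ZMod p) (((t q) : GLm p m) : Mat p m).det : ℤ) : ℂ)) := by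
    rw [Matrix.diagonal_neg, Matrix.isUnit_diagonal, Pi.isUnit_iff]
    exact fun q => isUnit_iff_ne_zero.mpr (neg_ne_zero.mpr (detChar_ne_zero _))
  have hrank : Fintype.card T ≤ Fintype.card ↥E := by
    calc Fintype.card T = (-Matrix.diagonal fun q : T => ((quadraticChar (ZMod p) (((t q) : GLm p m) : Mat p m).det : ℤ) : ℂ)).rank :=
          (Matrix.rank_of_isUnit _ hunit).symm
      _ = (Emat * Dθ * Emat.transpose).rank := by rw [hgram]
      _ ≤ (Emat * Dθ).rank := Matrix.rank_mul_le_left _ _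
      _ ≤ Emat.rank := Matrix.rank_mul_le_left _ _
      _ ≤ Fintype.card ↥E := Matrix.rank_le_card_width _
  rw [Fintype.card_coe, Finset.card_product, Fintype.card_coe, hEdef, Finset.card_univ_sdiff] at hrank
  have hPle : P.card ≤ Fintype.card (GLm p m) := Finset.card_le_univ P
  omega

/-- `|X⁻¹ Y Y⁻¹ Z| ≥ |X|·|Y|` for a separated triple with `Z ≠ ∅` (a translate of `X⁻¹Y` sits
inside, injectively). [folklore] -/
theorem card_XY_le_card_quadProducts (hsep : RankSep k X Y Z) (hZ : Z.Nonempty) :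
    X.card * Y.card ≤ (quadProducts X Y Z).card := by
  classical
  obtain ⟨z₀, hz₀⟩ := hZ
  obtain hY | ⟨y₀, hy₀⟩ := Y.eq_empty_or_nonempty
  · simp [hY]
  rw [← card_image_XY hsep ⟨z₀, hz₀⟩]
  refine (Finset.card_le_card_of_injOn (fun a => a * (y₀⁻¹ * z₀)) (fun a ha => ?_)
    (fun a _ b _ h => mul_right_cancel h))
  rw [Finset.mem_coe, Finset.mem_image] at ha
  obtain ⟨⟨x, y⟩, hxy, rfl⟩ := ha
  rw [Finset.mem_product] at hxy
  simpa [mul_assoc] using mem_quadProducts hxy.1 hxy.2 hy₀ hz₀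

/-- **Corollary**: `p` odd, `2k < m`, all three sets nonempty ⇒ `|X||Z| + |X||Y| ≤ |GL_m(𝔽_p)|`. -/
theorem card_XZ_add_card_XY_le (hp : p ≠ 2) (hkm : 2 * k < m) (hsep : RankSep k X Y Z)
    (hY : Y.Nonempty) (hZ : Z.Nonempty) :
    X.card * Z.card + X.card * Y.card ≤ Fintype.card (GLm p m) :=
  le_trans (Nat.add_le_add_left (card_XY_le_card_quadProducts hsep hZ) _)
    (card_XZ_add_card_quadProducts_le hp hkm hsep hY)

end Isotropy

end Summit.MatrixMultiplication.MatrixMultiplication.Theorems.LieRankDesigns.Negative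

end
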